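import Literature.MathematicalPhysics.QuantumFieldTheory.Balaban1983to89.B12NodeKnitRecord8
import Literature.MathematicalPhysics.QuantumFieldTheory.Balaban1983to89.B12EffectiveActionInvarianceT
import Literature.MathematicalPhysics.QuantumFieldTheory.Balaban1983to89.Node00.BackgroundActionReg
import Literature.MathematicalPhysics.QuantumFieldTheory.Balaban1983to89.B11Thm1CarrierTReg

/-!
# NODE N09 · [Balaban1987RG1] — the Theorem-3 member `smallCouplings → smallFieldInductive` for ANY binding world whose construction has a
# FORWARD-GENERATED flow and whose inductive-assumption clauses ARE node00-def-B's format predicate `IndAOfRecord` ∕ `IndAOfRecordT T'`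
# (the STAGE-FREE PLUG: NODE 00 Stage 8 satisfies it by `Node00.indAss_stage8_iff`, Stage 9 by the announced `indAss_stage9_iff` — seat
# node00-def-T [NODE00-DEF-T-G2-INTENT-3], pub-ymgap INBOX 2026-08-26)

T. Bałaban, *Renormalization group approach to lattice gauge field theories. I*, Commun. Math. Phys. **109** (1987) 249–301 [Balaban1987RG1]
(= [I]); [Balaban1985Variational] (= [B11]) Thm 1 p. 279.  TRACK A (YM-PLAN §2b, node N09 of 28), seat `pub-ymgap-dag-n09-a` (prover, KNIT-BY-NAME;
HUMAN RULING D-0062).  THEOREMS ONLY, def-free, sorry-free, standard axioms.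

WHY THIS FILE.  `B12NodeKnitRecord8` knits N09's Theorem-3 member at the Stage-8 record by unfolding `IsRecordOfRecord₈C` down to the Stage-8
parameters.  NODE 00's Stage 9 (`Node00.Record9`, being typed) builds a DIFFERENT datum (explicit represented densities, induced `R`) over
parameters extending Stage 8, with — per the definer's announced plug line — the SAME flow (`genFlow β₉ p.g₀`, `β₉ := betaOfRecord₈ θ.toStage8Params`)
and the SAME inductive-assumption clause (`indAss_stage9_iff` ≡ `indAss_stage8_iff`'s right-hand side); and `₉C ↛ ₈C` at the datum (LOCATED COST 2 of
the INTENT).  So the member is best knit ONCE against the two facts every such stage exposes about the run `P` of the world's construction `w.C`: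
  (F) `(w.C P).flow = FlowStepRuns.genFlow β P.g₀` (forward generation by (0.18)∕(0.20) with the history β-family `β`);
  (I) `∀ k ≤ K, (w.C P).IndAss k ↔ Node00.IndAOfRecord F N χ ε β P k (prefixOf (genSeq β P.g₀) k) (dom k) (A_k) (A^η(U_k ·)) (𝐄_k)`
      (or its transport-generic form `IndAOfRecordT T'`),
and then instantiated per stage in three lines (Stage 8: §4 below recovers `B12NodeKnitRecord8.thm3Member_stage8_of_hCompT`; Stage 9: the hour it lands).

## WHAT THIS FILE PROVES (0 sorry; axioms {propext, Classical.choice, Quot.sound})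
* §1 `rgEqH_genSeq_of_inInterval` — (0.20) in history form up to every horizon `k ≤ K` along an in-interval run of the forward-generated flow
  `genFlow β g₀` ITSELF (no construction: `FlowStepRuns.modelOf_forwardGenerated ∕ _haltsOutside ∕ _curries` + `rgEqH_of_inInterval`); `thm3Member_of_flow_of_steps`
  — the member at `(w, P)` from (F) and per-step clauses along RGEqH-histories.
* §2 THE PLUG (I), transport of record: `thm3Member_of_indAPlug_of_hCompT` ((1.1) on the domains + `HCompT`), `…_of_hRestrict` (+ `HRestrict`, intermediate
  uniqueness, orbit-point invariance), `…_of_middle` (only the middle composition clauses 1 ≤ j ≤ k−2 read an invariance of the effective actions), and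
  N09 itself from the own leaf: `b12_main_of_indAPlug_of_leaf_of_hCompT`.
* §3 THE PLUG (I) IN TRANSPORT-GENERIC FORM `IndAOfRecordT T'`: `thm3Member_of_indATPlug_of_hCompT`, and — over a LIFT-COVARIANT transport (p. 254: kernel
  transformations (0.13) with gauge-invariant kernels, `B12EffectiveActionInvarianceT.liftCovariant_of_kernel`) with lift-invariant `χ` — **`thm3Member_of_indATPlug_of_liftCovariant`**:
  the member from [B11] Thm 1 at the domains ((1.1), `HRestrict`, intermediate uniqueness) ALONE (`indAOfRecordT_atRecord_of_liftCovariant`).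
* §4 STAGE 8 RECOVERED: `thm3Member_stage8_via_plug` = §2 at `χ := chi7 θ`, `ε := θ.εbg`, `β := betaOfRecord₈ θ`, `dom k := domAltOfRecord θ.ν P.K k`, (F) by
  `Node00.flow_stage8`, (I) by `Node00.indAss_stage8_iff` — literally `B12NodeKnitRecord8.thm3Member_stage8_of_hCompT` re-derived through the plug (regression).

HONEST FRAMING: count-neutral kernel bookkeeping; (1.1) ∕ `HRestrict` ∕ the composition clauses ∕ the transport's mapping property are HYPOTHESES (located:
[B11] Thm 1 p. 279; [I] (0.21)–(0.23) p. 256, (2.16) p. 269, p. 254); nothing of Bałaban's asserted; conjunct 1 of N09 (the B12-group pin) untouched; one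
finite four-torus programme at fixed ε — NOT ℝ⁴, NOT infinite volume, NOT OS axioms, NOT a mass gap, NOT the Clay problem.

v1.1 (append-only; v1 declarations byte-identical; + import `Node00.BackgroundActionReg`, node00-def-B p419415): §5 — THE PLUG IN THE FINE CURRENCY
`IndAFineRT 𝓡 T'` ((0.23) terms read along the fixed minimiser over a regularity class `𝓡`): **`thm3Member_of_indAFinePlug`** — the member from (1.1) over `𝓡` on
the domains ALONE (`Node00.indAFineRT_atRecord`), any `𝓡`, any transport, every `K`; `b12_main_of_indAFinePlug_of_leaf`; `thm3Member_of_indAFinePlug_gconst`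
(g-constant χ: no locality input).  At `𝓡 := regB11` the existence clause is [B11] Thm 1 (8) at dag-n07-a's carrier — the `b11 → member` edge of N09 at the record.
v1.2 (append-only; + import `B11Thm1CarrierTReg`, dag-n07-a p419982): §6 — THAT EDGE IN THE KERNEL: **`thm3Member_of_indAFinePlug_of_thm1At`** — over the fine-currency
plug at `(regB11, B₃ε₁)` with level domains inside `{|V(∂p) − 1| < ε₁}`, [B11] Theorem 1 at the constants `C` for the socket problems `varProblemT F N P.K k (R k)`,
`k ≤ K`, gives the member (`B11Thm1CarrierTReg.thm1At_socket_gives_G8a` ∘ §5); `b12_main_of_indAFinePlug_of_leaf_of_thm1At` (+ the own leaf ⇒ N09 at the run).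
-/

noncomputable section

namespace Literature.MathematicalPhysics.QuantumFieldTheory.Balaban1983to89.B12NodeKnitIndAPlug

open DagBinding Node00 T4Continuum
open FlowStep (HBeta prefixOf RGEqH)
open FlowStepRuns (genSeq genFlow modelOf modelOf_forwardGenerated modelOf_haltsOutside modelOf_curries)
open T4FlagMemory (extd)
open B12RTGaugeInvariance254 (LiftInvariant)
open GaugeField (GaugeInvariant)
open B12NodeKnitRecord8 (rgEqH_of_le indAss_stage8_of_hCompT b12_main_of_leaf_of_thm3Member)
open B12EffectiveActionInvarianceT (hCompT_of_liftCovariant)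

variable (F : T4Family) (N : ℕ) [NeZero N]

/-! ## §1. (0.20) in history form along in-interval runs of the forward-generated flow itself; the member from per-step clauses -/

omit [NeZero N] in
/-- **(0.20) IN HISTORY FORM ALONG AN IN-INTERVAL RUN OF `genFlow β g₀`** (no construction needed): if the forward-generated couplings stay in `]0, γ]` up to
`K`, then `RGEqH k β (genSeq β g₀)` for every `k ≤ K` — `FlowStepRuns.rgEqH_of_inInterval` at the canonical construction `modelOf β` (whose flow IS `genFlow β g₀`,
`rfl`) and horizon monotonicity. [cite: Balaban1987RG1, (0.18)–(0.20) pp.255–256] -/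
theorem rgEqH_genSeq_of_inInterval (β : HBeta) (p : B12.RunParams) {γ : ℝ} (hI : (genFlow β p.g0).InInterval γ p.K) {k : ℕ}
    (hk : k ≤ p.K) : RGEqH k β (genSeq β p.g0) :=
  rgEqH_of_le
    (FlowStepRuns.rgEqH_of_inInterval (modelOf_forwardGenerated β) (modelOf_haltsOutside β) (modelOf_curries β) p hI) hk

variable {F N}

omit [NeZero N] in
/-- **THE THEOREM-3 MEMBER AT `(w, P)` FROM (F) AND PER-STEP CLAUSES**: if the run's flow is `genFlow β P.g₀` and `IndAss k` holds at every `k ≤ K` whenever the flow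
recursion holds up to `k`, then `smallCouplings → smallFieldInductive` (any interval constant `w.γ`). [cite: Balaban1987RG1, Thm 1 p.259 and Thm 3 p.264] -/
theorem thm3Member_of_flow_of_steps {w : WorldP} {P : B12.RunParams} (β : HBeta) (hflow : (w.C P).flow = genFlow β P.g0)
    (hind : ∀ k, k ≤ P.K → RGEqH k β (genSeq β P.g0) → (w.C P).IndAss k) :
    (leavesP w P).smallCouplings → (leavesP w P).smallFieldInductive := by
  intro hsc k hk
  have hsc' : (w.C P).flow.InInterval w.γ P.K := hsc
  rw [hflow] at hsc'
  exact hind k hk (rgEqH_genSeq_of_inInterval β P hsc' hk)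

/-! ## §2. THE PLUG (I) at the transport of record: the member from (1.1) on the domains + the composition clauses -/

section Plug

variable {w : WorldP} {P : B12.RunParams} (χ : (K : ℕ) → (ℕ → ℝ) → (k : ℕ) → Density (F.P K) k (SU N)) (ε : ℝ) (β : HBeta)
  (dom : (k : ℕ) → Set (GaugeField (F.P P.K) k (SU N)))
  (hflow : (w.C P).flow = genFlow β P.g0)
  (hind : ∀ k, k ≤ P.K → ((w.C P).IndAss k ↔
    IndAOfRecord F N χ ε β P k (prefixOf (genSeq β P.g0) k) (dom k) (effActionOfRecord F N χ β P k) (wilsonBGOfRecord F N ε P k)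
      (EkOfRecord F N χ ε β P k)))
  (hχ : ∀ k, k ≤ P.K → ∀ n ≤ k, χ P.K (extd (prefixOf (genSeq β P.g0) k)) n = χ P.K (genSeq β P.g0) n)

include hflow hind hχ in
/-- **THE MEMBER THROUGH THE PLUG, from (1.1) on the domains and `HCompT`** (node00-def-B's `indAOfRecord_atRecord` per level; (0.20) derived by §1; χ-locality a
hypothesis of the plug, `rfl`-dischargeable for pointwise families such as `chi7`). [cite: Balaban1987RG1, Thm 3 p.264, (1.1)–(1.3) p.260 and (0.22)–(0.23) p.256] -/
theorem thm3Member_of_indAPlug_of_hCompT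
    (h11 : ∀ k, k ≤ P.K → ∀ V ∈ dom k, UkExists F N P.K k ε V ∧ UniqueUkOrbit F N P.K k ε V)
    (hcomp : ∀ k, k ≤ P.K → HCompT F N (TOfRecord F N) χ ε P.K (genSeq β P.g0) k (dom k)) :
    (leavesP w P).smallCouplings → (leavesP w P).smallFieldInductive :=
  thm3Member_of_flow_of_steps β hflow fun k hk hrg =>
    (hind k hk).2 (indAOfRecord_atRecord F N χ ε β P k (dom k) (hχ k hk) hrg (h11 k hk) (hcomp k hk))

include hflow hind hχ in
/-- **THE MEMBER THROUGH THE PLUG, from (1.1), `HRestrict`, intermediate uniqueness and the orbit-point invariance of `A_j ∘ Ū^j`** (inline, domain-restricted).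
[cite: Balaban1987RG1, Thm 3 p.264, (0.21) p.256, (1.1) p.260 and (2.16) p.269; Balaban1985Variational, Thm 1 (8)–(10) p.279] -/
theorem thm3Member_of_indAPlug_of_hRestrict
    (h11 : ∀ k, k ≤ P.K → ∀ V ∈ dom k, UkExists F N P.K k ε V ∧ UniqueUkOrbit F N P.K k ε V)
    (hres : ∀ k, k ≤ P.K → HRestrict F N ε P.K k (dom k))
    (huniq : ∀ k, k ≤ P.K → ∀ V ∈ dom k, ∀ j < k,
      UniqueUkOrbit F N P.K (j + 1) ε (Averaging.iter (avOfRecord F N P.K) (j + 1) (Uk F N P.K k ε V)))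
    (hinv : ∀ k, k ≤ P.K → ∀ V ∈ dom k, ∀ j < k, ∀ u : GaugeTransf (F.P P.K) 0 (SU N), B12GaugeOrbits021.IsResidual (j + 1) u →
      effActionH F N χ P.K (genSeq β P.g0) j (Averaging.iter (avOfRecord F N P.K) j (GaugeField.gaugeAct u (Uk F N P.K k ε V))) =
        effActionH F N χ P.K (genSeq β P.g0) j (Averaging.iter (avOfRecord F N P.K) j (Uk F N P.K k ε V))) :
    (leavesP w P).smallCouplings → (leavesP w P).smallFieldInductive := by
  refine thm3Member_of_indAPlug_of_hCompT χ ε β dom hflow hind hχ h11 fun k hk => ?_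
  have hO := hOrbit_of_hRestrict_of_unique F N (hres k hk) (huniq k hk)
  intro V hV j hj
  obtain ⟨u, hu, hEq⟩ := hO V hV j hj
  rw [hEq]
  exact hinv k hk V hV j hj u hu

include hflow hind hχ in
/-- **THE MEMBER THROUGH THE PLUG WITH THE INVARIANCE INPUT REDUCED TO THE MIDDLE CLAUSES** (top clause automatic, bottom clause = `HOrbit`'s + Wilson gauge
invariance: `B12NodeKnitRecord8.hCompT_of_middle`). [cite: Balaban1987RG1, Thm 3 p.264, (0.21)–(0.23) p.256 and (2.16) p.269] -/
theorem thm3Member_of_indAPlug_of_middle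
    (h11 : ∀ k, k ≤ P.K → ∀ V ∈ dom k, UkExists F N P.K k ε V ∧ UniqueUkOrbit F N P.K k ε V)
    (hO0 : ∀ k, k ≤ P.K → 1 < k → ∀ V ∈ dom k,
      B12GaugeOrbits021.OrbitRel 1 (Uk F N P.K k ε V) (Uk F N P.K 1 ε (Averaging.iter (avOfRecord F N P.K) 1 (Uk F N P.K k ε V))))
    (hmid : ∀ k, k ≤ P.K → ∀ V ∈ dom k, ∀ j, 1 ≤ j → j + 1 < k →
      effActionH F N χ P.K (genSeq β P.g0) j
          (Averaging.iter (avOfRecord F N P.K) j (Uk F N P.K (j + 1) ε (Averaging.iter (avOfRecord F N P.K) (j + 1) (Uk F N P.K k ε V)))) =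
        effActionH F N χ P.K (genSeq β P.g0) j (Averaging.iter (avOfRecord F N P.K) j (Uk F N P.K k ε V))) :
    (leavesP w P).smallCouplings → (leavesP w P).smallFieldInductive :=
  thm3Member_of_indAPlug_of_hCompT χ ε β dom hflow hind hχ h11 fun k hk =>
    B12NodeKnitRecord8.hCompT_of_middle (TOfRecord F N) χ (genSeq β P.g0) (fun V hV => (h11 k hk V hV).1)
      (fun V hV h1k => hO0 k hk h1k V hV) (fun V hV j hj1 hj2 => hmid k hk V hV j hj1 hj2)

include hflow hind hχ in
/-- **N09 AT `(w, P)` THROUGH THE PLUG, from the own leaf `b12` and the [B11]-side inputs (1.1) + `HCompT`.** [cite: Balaban1987RG1, Lemma 4 (3.53) p.280, Thm 3 p.264 and (1.1)–(1.3) p.260] -/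
theorem b12_main_of_indAPlug_of_leaf_of_hCompT (h12 : (leavesP w P).b12)
    (h11 : ∀ k, k ≤ P.K → ∀ V ∈ dom k, UkExists F N P.K k ε V ∧ UniqueUkOrbit F N P.K k ε V)
    (hcomp : ∀ k, k ≤ P.K → HCompT F N (TOfRecord F N) χ ε P.K (genSeq β P.g0) k (dom k)) : Dag.B12_main (leavesP w P) :=
  b12_main_of_leaf_of_thm3Member h12 (thm3Member_of_indAPlug_of_hCompT χ ε β dom hflow hind hχ h11 hcomp)

end Plug

/-! ## §3. THE PLUG IN TRANSPORT-GENERIC FORM `IndAOfRecordT T'`; over a lift-covariant transport the member from [B11] Thm 1 alone -/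

section PlugT

variable {w : WorldP} {P : B12.RunParams} (T' : Transport F N) (χ : (K : ℕ) → (ℕ → ℝ) → (k : ℕ) → Density (F.P K) k (SU N)) (ε : ℝ)
  (β : HBeta) (dom : (k : ℕ) → Set (GaugeField (F.P P.K) k (SU N)))
  (hflow : (w.C P).flow = genFlow β P.g0)
  (hind : ∀ k, k ≤ P.K → ((w.C P).IndAss k ↔
    IndAOfRecordT F N T' χ ε β P k (prefixOf (genSeq β P.g0) k) (dom k) (effActionOfRecordT F N T' χ β P k) (wilsonBGOfRecord F N ε P k)
      (EkOfRecordT F N T' χ ε β P k)))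
  (hχ : ∀ k, k ≤ P.K → ∀ n ≤ k, χ P.K (extd (prefixOf (genSeq β P.g0) k)) n = χ P.K (genSeq β P.g0) n)

include hflow hind hχ in
/-- **THE MEMBER THROUGH THE TRANSPORT-GENERIC PLUG, from (1.1) on the domains + `HCompT T'`** (node00-def-B's `indAOfRecordT_atRecord`).
[cite: Balaban1987RG1, Thm 3 p.264, (1.1)–(1.3) p.260 and (0.22)–(0.23) p.256] -/
theorem thm3Member_of_indATPlug_of_hCompT
    (h11 : ∀ k, k ≤ P.K → ∀ V ∈ dom k, UkExists F N P.K k ε V ∧ UniqueUkOrbit F N P.K k ε V)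
    (hcomp : ∀ k, k ≤ P.K → HCompT F N T' χ ε P.K (genSeq β P.g0) k (dom k)) :
    (leavesP w P).smallCouplings → (leavesP w P).smallFieldInductive :=
  thm3Member_of_flow_of_steps β hflow fun k hk hrg =>
    (hind k hk).2 (indAOfRecordT_atRecord F N T' χ ε β P k (dom k) (hχ k hk) hrg (h11 k hk) (hcomp k hk))

include hflow hind hχ in
/-- **THE MEMBER OVER A LIFT-COVARIANT TRANSPORT FROM [B11] THM 1 ALONE**: if `T'` maps lift-invariant densities to gauge-invariant ones (kernel transformations
(0.13) with gauge-invariant kernels do — `B12EffectiveActionInvarianceT.liftCovariant_of_kernel`) and the characteristic functions along the run are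
lift-invariant, then the composition input is a theorem (`hCompT_of_liftCovariant`) and the member follows from (1.1) on the domains, `HRestrict` and (1.1)-uniqueness
at the intermediate levels — N07's content at the record, nothing else. [cite: Balaban1987RG1, Thm 3 p.264, (0.13) p.254, p.263 and (2.16) p.269; Balaban1985Variational, Thm 1 p.279] -/
theorem thm3Member_of_indATPlug_of_liftCovariant
    (hT : ∀ K j, j + 1 ≤ (F.P K).m + (F.P K).K → ∀ ρ : Density (F.P K) j (SU N), LiftInvariant ρ → GaugeInvariant (T' K j ρ))
    (hχinv : ∀ j, j + 1 ≤ (F.P P.K).m + (F.P P.K).K → LiftInvariant (χ P.K (genSeq β P.g0) j))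
    (h11 : ∀ k, k ≤ P.K → ∀ V ∈ dom k, UkExists F N P.K k ε V ∧ UniqueUkOrbit F N P.K k ε V)
    (hres : ∀ k, k ≤ P.K → HRestrict F N ε P.K k (dom k))
    (huniq : ∀ k, k ≤ P.K → ∀ V ∈ dom k, ∀ j < k,
      UniqueUkOrbit F N P.K (j + 1) ε (Averaging.iter (avOfRecord F N P.K) (j + 1) (Uk F N P.K k ε V))) :
    (leavesP w P).smallCouplings → (leavesP w P).smallFieldInductive :=
  thm3Member_of_indATPlug_of_hCompT T' χ ε β dom hflow hind hχ h11 fun k hk =>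
    hCompT_of_liftCovariant F N T' hT χ P.K (genSeq β P.g0) hχinv hk (hres k hk) (huniq k hk)

end PlugT

/-! ## §4. STAGE 8 RECOVERED THROUGH THE PLUG (regression against `B12NodeKnitRecord8`) -/

/-- **Stage 8 through the plug**: at a world bound to the Stage-8 construction, (F) is `Node00.flow_stage8` and (I) is `Node00.indAss_stage8_iff`, χ-locality is
`B12NodeKnitRecord8.chi7_extd_prefixOf`; the member from (1.1) on `domAltOfRecord` + `HCompT` — the statement of `B12NodeKnitRecord8.thm3Member_stage8_of_hCompT`,
re-derived (the Stage-9 twin is the same three lines at `indAss_stage9_iff` ∕ `flow_datumOfRecord₉`). [cite: Balaban1987RG1, Thm 3 p.264 and (1.1)–(1.3) p.260] -/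
theorem thm3Member_stage8_via_plug (θ : Stage8Params F N) {w : WorldP} (hC : w.C = (datumOfRecord₅ F N (θ.toStage5 F N)).C)
    (P : B12.RunParams)
    (h11 : ∀ k, k ≤ P.K → ∀ V ∈ domAltOfRecord F N θ.ν P.K k, UkExists F N P.K k θ.εbg V ∧ UniqueUkOrbit F N P.K k θ.εbg V)
    (hcomp : ∀ k, k ≤ P.K → HCompT F N (TOfRecord F N) (chi7 F N θ) θ.εbg P.K (genSeq (betaOfRecord₈ F N θ) P.g0) k
      (domAltOfRecord F N θ.ν P.K k)) :
    (leavesP w P).smallCouplings → (leavesP w P).smallFieldInductive := by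
  refine thm3Member_of_indAPlug_of_hCompT (chi7 F N θ) θ.εbg (betaOfRecord₈ F N θ) (fun k => domAltOfRecord F N θ.ν P.K k)
    ?_ (fun k _ => ?_) (fun k _ => B12NodeKnitRecord8.chi7_extd_prefixOf F N θ P.K k _) h11 hcomp
  · rw [hC]; exact flow_stage8 F N θ P
  · rw [hC]; exact indAss_stage8_iff F N θ P k

/-! ## §5 (v1.1, append-only). THE PLUG IN THE FINE CURRENCY `IndAFineRT 𝓡 T'` (node00-def-B's `Node00.BackgroundActionReg`, p419415): over ANY
regularity class `𝓡` and ANY transport `T'`, the member from (1.1) over `𝓡` on the domains ALONE — no composition clause, no invariance, no transport property -/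

section PlugFine

variable {w : WorldP} {P : B12.RunParams} (𝓡 : RegClass F N) (T' : Transport F N)
  (χ : (K : ℕ) → (ℕ → ℝ) → (k : ℕ) → Density (F.P K) k (SU N)) (ε : ℝ) (β : HBeta) (dom : (k : ℕ) → Set (GaugeField (F.P P.K) k (SU N)))
  (hflow : (w.C P).flow = genFlow β P.g0)
  (hind : ∀ k, k ≤ P.K → ((w.C P).IndAss k ↔
    IndAFineRT F N 𝓡 T' χ ε β P k (prefixOf (genSeq β P.g0) k) (dom k) (effActionOfRecordT F N T' χ β P k)
      (wilsonBGOfRecordR F N 𝓡 ε P k) (EkOfRecordRT F N 𝓡 T' χ ε β P k)))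
  (hχ : ∀ k, k ≤ P.K → ∀ n ≤ k, χ P.K (extd (prefixOf (genSeq β P.g0) k)) n = χ P.K (genSeq β P.g0) n)

include hflow hind hχ in
/-- **THE MEMBER THROUGH THE FINE-CURRENCY PLUG, from (1.1) over `𝓡` on the domains ALONE**: for any binding world whose run flow is `genFlow β P.g₀` and whose
`IndAss k` IS node00-def-B's `IndAFineRT 𝓡 T' χ ε β …` at the record's own objects (the (0.23) terms read along the fixed minimiser `U_k(V)` over the class `𝓡`),
`smallCouplings → smallFieldInductive` follows from `UkExistsR 𝓡 ∧ UniqueUkOrbitR 𝓡` on `dom k`, `k ≤ K` — `Node00.indAFineRT_atRecord` per level, (0.20) by §1,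
χ-locality by `hχ`.  At `𝓡 := regB11` the existence clause is [B11] Thm 1 (8) at dag-n07-a's carrier (`Node00.ukExistsR_regB11_iff`; bridge to `B11Thm1CarrierT`
certified by node00-def-B, pub-ymgap INBOX 2026-08-26) — the in-edge `b11` of `Dag.B12_main` at the record FEEDS the member; NO composition, invariance or transport input, every `K`.
[cite: Balaban1987RG1, Thm 3 p.264, (1.1)–(1.3) p.260 and (0.22)–(0.24) pp.256–257; Balaban1985Variational, Thm 1 p.279] -/
theorem thm3Member_of_indAFinePlug
    (h11 : ∀ k, k ≤ P.K → ∀ V ∈ dom k, UkExistsR F N 𝓡 P.K k ε V ∧ UniqueUkOrbitR F N 𝓡 P.K k ε V) :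
    (leavesP w P).smallCouplings → (leavesP w P).smallFieldInductive :=
  thm3Member_of_flow_of_steps β hflow fun k hk hrg =>
    (hind k hk).2 (indAFineRT_atRecord 𝓡 T' χ ε β P k (dom k) (hχ k hk) hrg (h11 k hk))

include hflow hind hχ in
/-- **N09 AT `(w, P)` THROUGH THE FINE-CURRENCY PLUG**: the own leaf `b12` + (1.1) over `𝓡` on the domains ⇒ `Dag.B12_main (leavesP w P)`.
[cite: Balaban1987RG1, Lemma 4 (3.53) p.280, Thm 3 p.264 and (1.1)–(1.3) p.260] -/
theorem b12_main_of_indAFinePlug_of_leaf (h12 : (leavesP w P).b12)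
    (h11 : ∀ k, k ≤ P.K → ∀ V ∈ dom k, UkExistsR F N 𝓡 P.K k ε V ∧ UniqueUkOrbitR F N 𝓡 P.K k ε V) : Dag.B12_main (leavesP w P) :=
  b12_main_of_leaf_of_thm3Member h12 (thm3Member_of_indAFinePlug 𝓡 T' χ ε β dom hflow hind hχ h11)

include hflow hind in
/-- **g-CONSTANT χ** (print's small-field functions with fixed thresholds, [I] (0.16) p. 255): the locality input is `rfl`, so the member needs ONLY (F), (I) and (1.1)
over `𝓡` (`Node00.indAFineRT_atRecord_gconst`). [cite: Balaban1987RG1, (0.16) p.255, Thm 3 p.264 and (1.1)–(1.3) p.260] -/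
theorem thm3Member_of_indAFinePlug_gconst (χ₀ : (K k : ℕ) → Density (F.P K) k (SU N)) (hχ₀ : χ = fun K _ k => χ₀ K k)
    (h11 : ∀ k, k ≤ P.K → ∀ V ∈ dom k, UkExistsR F N 𝓡 P.K k ε V ∧ UniqueUkOrbitR F N 𝓡 P.K k ε V) :
    (leavesP w P).smallCouplings → (leavesP w P).smallFieldInductive := by
  subst hχ₀
  exact thm3Member_of_flow_of_steps β hflow fun k hk hrg =>
    (hind k hk).2 (indAFineRT_atRecord_gconst 𝓡 T' χ₀ ε β P k (dom k) hrg (h11 k hk))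

end PlugFine

/-! ## §6 (v1.2, append-only). THE `b11 → member` EDGE OF N09 IN THE KERNEL: the Theorem-3 member from [B11] THEOREM 1 AT THE SOCKET
(dag-n07-a's `B11Thm1CarrierTReg`, p419982) — over the fine-currency plug at `𝓡 := regB11`, radius `B₃ε₁`, domains inside `{V : |V(∂p) − 1| < ε₁}` -/

section FromThm1

variable {w : WorldP} {P : B12.RunParams} (T' : Transport F N)
  (χ : (K : ℕ) → (ℕ → ℝ) → (k : ℕ) → Density (F.P K) k (SU N)) (β : HBeta) (dom : (k : ℕ) → Set (GaugeField (F.P P.K) k (SU N)))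
  (C : B11Thm1.Consts) {ε₁ : ℝ}
  (hflow : (w.C P).flow = genFlow β P.g0)
  (hind : ∀ k, k ≤ P.K → ((w.C P).IndAss k ↔
    IndAFineRT F N (regB11 F N) T' χ (C.B₃ * ε₁) β P k (prefixOf (genSeq β P.g0) k) (dom k) (effActionOfRecordT F N T' χ β P k)
      (wilsonBGOfRecordR F N (regB11 F N) (C.B₃ * ε₁) P k) (EkOfRecordRT F N (regB11 F N) T' χ (C.B₃ * ε₁) β P k)))
  (hχ : ∀ k, k ≤ P.K → ∀ n ≤ k, χ P.K (extd (prefixOf (genSeq β P.g0) k)) n = χ P.K (genSeq β P.g0) n)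

include hflow hind hχ in
/-- **N09's THEOREM-3 MEMBER FROM [B11] THEOREM 1 AT THE RECORD'S SOCKETS** (the DAG edge `b11 → (… → smallFieldInductive)` of `Dag.B12_main` realised in
the kernel): for a binding world whose run flow is `genFlow β P.g₀` and whose `IndAss k` IS def-B's fine-currency clause over the (2)-class `regB11` at radius
`B₃ε₁` with level-`k` domains inside `{V : |V(∂p) − 1| < ε₁}` (`0 < ε₁ ≤ a₁`), [Balaban1985Variational] Theorem 1 AT THE CONSTANTS `C` for dag-n07-a's socket
problems `varProblemT F N P.K k (R k)` at every level `k ≤ K` (its Theorem-1 slot at a B11 pin) gives the member — `B11Thm1CarrierTReg.thm1At_socket_gives_G8a` ⇒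
`UkExistsR regB11 ∧ UniqueUkOrbitR regB11` on the domains ⇒ §5.  NO composition, invariance or transport input; every `K`.
[cite: Balaban1985Variational, Thm 1 (6)–(8) pp.278–279; Balaban1987RG1, Thm 3 p.264, (1.1)–(1.3) p.260 and (0.22)–(0.24) pp.256–257] -/
theorem thm3Member_of_indAFinePlug_of_thm1At (hε₁ : 0 < ε₁) (hε₁a : ε₁ ≤ C.a₁)
    (R : (k : ℕ) → B11Thm1CarrierT.RegCarrierT F N P.K)
    (hthm1 : ∀ k, k ≤ P.K → B11Thm1.Thm1At C (B11Thm1CarrierT.varProblemT F N P.K k (R k)))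
    (hdom : ∀ k, k ≤ P.K → ∀ V ∈ dom k, PlaqSmall ε₁ V) :
    (leavesP w P).smallCouplings → (leavesP w P).smallFieldInductive :=
  thm3Member_of_indAFinePlug (regB11 F N) T' χ (C.B₃ * ε₁) β dom hflow hind hχ fun k hk V hV =>
    B11Thm1CarrierTReg.thm1At_socket_gives_G8a (R k) C (hthm1 k hk) hε₁ hε₁a V (hdom k hk V hV)

include hflow hind hχ in
/-- **N09 AT `(w, P)` FROM ITS OWN LEAF AND [B11] THEOREM 1 AT THE SOCKETS** (in-edge N07 at the record + conjunct 1): `Dag.B12_main (leavesP w P)`.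
[cite: Balaban1987RG1, Lemma 4 (3.53) p.280 and Thm 3 p.264; Balaban1985Variational, Thm 1 p.279] -/
theorem b12_main_of_indAFinePlug_of_leaf_of_thm1At (h12 : (leavesP w P).b12) (hε₁ : 0 < ε₁) (hε₁a : ε₁ ≤ C.a₁)
    (R : (k : ℕ) → B11Thm1CarrierT.RegCarrierT F N P.K)
    (hthm1 : ∀ k, k ≤ P.K → B11Thm1.Thm1At C (B11Thm1CarrierT.varProblemT F N P.K k (R k)))
    (hdom : ∀ k, k ≤ P.K → ∀ V ∈ dom k, PlaqSmall ε₁ V) : Dag.B12_main (leavesP w P) :=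
  b12_main_of_leaf_of_thm3Member h12 (thm3Member_of_indAFinePlug_of_thm1At T' χ β dom C hflow hind hχ hε₁ hε₁a R hthm1 hdom)

end FromThm1

end Literature.MathematicalPhysics.QuantumFieldTheory.Balaban1983to89.B12NodeKnitIndAPlug

end
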